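import Mathlib
import Summits.QuantumFields.BalabanUV.Beta.AnalyticWalkSum216Recomb

/-!
# [Balaban1988RG2Cluster] (2.16) p. 16 ∕ [13] (3.108) p. 416 «The constant O(1) depends on d and L only»: the algebra of
# walk-term families in the VOLUME-FREE currency — ROW DATA (summed majorant with localised row sums, the hypotheses
# of `AnalyticWalkSum216.wrs_termSum_sub` verbatim) is closed under re-indexing, sums, bounded scalars and PRODUCTS
# with constants `ρ + ρ′`, `Xρ`, `ρρ′` that carry NO volume factor (cell topic `Summits/QuantumFields/BalabanUV/Beta`;
# row-D4 rider (ρ3), census `BETA/REMAINDER-BETA.md` §10; owner XREAD C-an4-89 finding (f))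

HONEST FRAMING (cell rule).  Discharging `BetaPertH` makes Bałaban's UV stability UNCONDITIONAL — a real
constructive-QFT result; NOT the continuum limit, NOT the Clay problem.  This module discharges NOTHING of `BetaPertH`.
WHY THIS FILE (a correction of CURRENCY, not of a theorem).  The gen-37 modules `AnalyticWalkSum216Algebra∕Neumann∕
Recomb` bundle the TERMWISE hypotheses of `AnalyticWalkSum216.wrs_termSum_sub_of_termwise` (`TermData`: one constant
`ρ_w` per term, `Σ_w ρ_w ≤ ρ`).  For a translation-covariant family of walk terms on a large torus `Σ_w ρ_w` counts every
walk once and grows with the VOLUME, whereas [13] (3.108)∕[II] (2.16) are uniform in the volume: only walks meeting a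
given row contribute to that row.  The volume-free hypotheses are those of `AnalyticWalkSum216.wrs_termSum_sub` itself —
entrywise summable majorants `m_w` and localised rows of the SUMMED majorant, `Σ_j (Σ_w m_w(i,j)) e^{κd(i,j)} ≤ ρ` — and
this is the currency in which the co-owner road's A3-loc states its bounds (`UnitLatticeDecoratedChains.wrs_decoratedSum`:
«no volume factor»; owner XREAD C-an4-89 (f)).  This file re-runs the closure algebra in that currency (`RowData`); the
sibling `AnalyticWalkSum216RowNeumann` does the Neumann series and the Woodbury recombination.  `TermData → RowData`
(`rowData_of_termData`), so nothing landed is lost.  [folklore]; NO class change on any GAPS row; NOT summit progress.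
Unit `b2b-balaban-beta-an4-g37` (owner of `BINDER-OWNERS.md` row D4); cell `GAPS.md` C-an4-90.

CITATION HEADER (lean-in-tree rule).  [II] = T. Bałaban, *Renormalization group approach to lattice gauge field theories.
II. Cluster expansions*, Commun. Math. Phys. **116**, 1–22 (1988) [Balaban1988RG2Cluster], p. 16 [PDF 16] (render
`HOME/b2b-balaban-ref1/pages/1988-cmp116-rg-II-cluster/…-p016-x2.png`, READ AS IMAGE by this lineage gens 32–36),
verbatim: *"|R₁(b, b′)| ≦ (O(1)e^{−1∕3δ₀M} + O(α₀ + α₁))exp(−½δ₀|b₋ − b′₋|). (2.16)"* — a KERNEL bound with volume-free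
constants.  [13] = T. Bałaban, *Propagators for lattice gauge theories in a background field*, Commun. Math. Phys. **99**,
389–434 (1985) [Balaban1985BackgroundPropagators], Thm 3.10 p. 416 [PDF 28], verbatim: *"The constant O(1) depends on d
and L only. From (3.108) it follows that the expansion (3.107) is convergent in all norms in the inequalities
(3.42)–(3.47)."*  Nothing printed is asserted: the sentences LOCATE the volume-uniformity that the currency must respect.

WHAT IS CERTIFIED HERE (kernel, sorry-free; [folklore]; notation of the siblings).
§1 `RowData κ d R T m ρ` := (termwise analyticity, termwise σ-uniform majorant, `hsum : ∀ i j, Summable (m · i j)`,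
   `hρ : ∀ i, Σ_j majSum m i j·e^{κ d(i,j)} ≤ ρ`) — EXACTLY the hypotheses of `AnalyticWalkSum216.wrs_termSum_sub`;
   derived `m ≥ 0`, `majSum ≥ 0`, `wrs_majSum` (`WRS κ d (majSum m) ρ` as a real matrix), `summable_norm`, the ENDs
   `wrs_termSum`∕`wrs_termSum_sub` BY NAME; `rowData_of_termData` (ρ := any bound of `Σ_w ρ_w`).
§2 CLOSURE with volume-free constants: `reindex` (ρ), `sum` (ρ + ρ′; `majSum_sum`), `smul` (‖c‖ ≤ X ⇒ Xρ; `majSum_smul`),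
   **`prod`** (ρρ′: `majSum_prod` — the summed product majorant IS the matrix product of the summed majorants, by the
   Cauchy product over `W × V` and the finite middle sum — and `B13PerturbativeStep.WRS.mul` on the real majorants),
   with `termSum_prod'` (the sibling's multiplicativity under row data).
§3 Non-vacuity.
NOT CLAIMED.  Any expansion of Bałaban's operators; U-localisation; Neumann∕recombination (sibling).  NOT summit progress.
PRIOR ART IN THE TREE (searched 2026-08-20): `AnalyticWalkSum216` (an4 gen 32: the consumer, whose `wrs_termSum_sub`
already had the volume-free hypotheses — this file makes the ALGEBRA match it); `AnalyticWalkSum216Algebra` (gen 37: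
the termwise twin; `prodTerm`∕`prodMaj`∕`tsum_mul_apply_of_summable_norm` re-used BY NAME).
-/

namespace Summit.QuantumFields.BalabanUV.Beta.AnalyticWalkSum216RowData

open Metric Set
open Literature.MathematicalPhysics.QuantumFieldTheory.Balaban1983to89
open B13PerturbativeStep (WRS WeightHyp wrs)
open Summit.QuantumFields.BalabanUV.Beta.AnalyticWalkSum216 (termSum majSum norm_termSum_le
  majSum_row_le_of_termwise wrs_termSum_sub differentiableOn_termSum)
open Summit.QuantumFields.BalabanUV.Beta.AnalyticWalkSum216Algebra (TermData prodTerm prodMaj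
  tsum_mul_apply_of_summable_norm)

noncomputable section

variable {n : Type*} [Fintype n] {W V : Type*} {κ : ℝ} {d : n → n → ℝ} {R : ℝ}

/-! ## §1 Row data: the volume-free currency -/

/-- **ROW DATA** of a walk-term family on the disc `‖σ‖ < R` at rate `κ`: termwise analyticity, termwise σ-uniform
majorants `m_w`, ENTRYWISE summability of the majorants, and localised rows of the SUMMED majorant
`Σ_j (Σ_w m_w(i,j))e^{κd(i,j)} ≤ ρ` — exactly the hypotheses of `AnalyticWalkSum216.wrs_termSum_sub`.  Only the walks
meeting row `i` contribute to `ρ` at `i`: no volume factor ([13] Thm 3.10: «depends on d and L only»). [folklore] -/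
structure RowData (κ : ℝ) (d : n → n → ℝ) (R : ℝ) (T : W → ℂ → Matrix n n ℂ) (m : W → n → n → ℝ) (ρ : ℝ) :
    Prop where
  /-- (i) termwise analyticity on the disc. -/
  ha : ∀ w i j, DifferentiableOn ℂ (fun σ => T w σ i j) (ball 0 R)
  /-- (ii) the termwise σ-uniform entrywise majorant. -/
  hm : ∀ w, ∀ σ ∈ ball (0 : ℂ) R, ∀ i j, ‖T w σ i j‖ ≤ m w i j
  /-- (iii) entrywise summability of the majorants. -/
  hsum : ∀ i j, Summable fun w => m w i j
  /-- (iv) localised rows of the summed majorant. -/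
  hρ : ∀ i, ∑ j, majSum m i j * Real.exp (κ * d i j) ≤ ρ

namespace RowData

variable {T : W → ℂ → Matrix n n ℂ} {m : W → n → n → ℝ} {ρ : ℝ}

/-- The majorants are nonnegative (the disc is inhabited). [folklore] -/
theorem m_nonneg (h : RowData κ d R T m ρ) (hR : 0 < R) (w : W) (i j : n) : 0 ≤ m w i j :=
  (norm_nonneg _).trans (h.hm w 0 (mem_ball_self hR) i j)

/-- The summed majorant is nonnegative. [folklore] -/
theorem majSum_nonneg (h : RowData κ d R T m ρ) (hR : 0 < R) (i j : n) : 0 ≤ majSum m i j :=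
  tsum_nonneg fun w => h.m_nonneg hR w i j

/-- **The summed majorant as a real MATRIX has weighted row sums `≤ ρ`** (its entries are their own norms). [folklore] -/
theorem wrs_majSum (h : RowData κ d R T m ρ) (hR : 0 < R) : WRS κ d (Matrix.of (majSum m)) ρ := fun i => by
  refine le_of_eq_of_le (Finset.sum_congr rfl fun j _ => ?_) (h.hρ i)
  rw [Matrix.of_apply, Real.norm_of_nonneg (h.majSum_nonneg hR i j)]

/-- The constant is nonnegative (bonds exist). [folklore] -/
theorem ρ_nonneg [Nonempty n] (h : RowData κ d R T m ρ) (hR : 0 < R) : 0 ≤ ρ := by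
  obtain ⟨i⟩ := ‹Nonempty n›
  exact (Finset.sum_nonneg fun j _ => mul_nonneg (h.majSum_nonneg hR i j) (Real.exp_pos _).le).trans (h.hρ i)

/-- Absolute summability of the entrywise walk sums on the disc. [folklore] -/
theorem summable_norm (h : RowData κ d R T m ρ) {σ : ℂ} (hσ : σ ∈ ball (0 : ℂ) R) (i j : n) :
    Summable fun w => ‖T w σ i j‖ :=
  .of_nonneg_of_le (fun _ => norm_nonneg _) (fun w => h.hm w σ hσ i j) (h.hsum i j)

/-- Summability of the entrywise walk sums on the disc. [folklore] -/
theorem summable (h : RowData κ d R T m ρ) {σ : ℂ} (hσ : σ ∈ ball (0 : ℂ) R) (i j : n) :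
    Summable fun w => T w σ i j :=
  (h.summable_norm hσ i j).of_norm

/-- **END (2.16)-shape at every point of the disc**: `WRS κ d (termSum T σ) ρ`. [cite: Balaban1988RG2Cluster, (2.16) p.16] -/
theorem wrs_termSum (h : RowData κ d R T m ρ) {σ : ℂ} (hσ : σ ∈ ball (0 : ℂ) R) : WRS κ d (termSum T σ) ρ :=
  B13PerturbativeStep.WRS.of_majorant (fun i j => norm_termSum_le h.hm h.hsum hσ i j) h.hρ

/-- **END (2.16)-shape for the difference**: `WRS κ d (termSum T σ − termSum T 0) (2ρ/R·‖σ‖)` — an4's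
`wrs_termSum_sub` BY NAME, whose hypotheses `RowData` is. [cite: Balaban1988RG2Cluster, (2.16) p.16] -/
theorem wrs_termSum_sub (h : RowData κ d R T m ρ) (hR : 0 < R) {σ : ℂ} (hσ : σ ∈ ball (0 : ℂ) R) :
    WRS κ d (termSum T σ - termSum T 0) (2 * ρ / R * ‖σ‖) :=
  AnalyticWalkSum216.wrs_termSum_sub hR h.ha h.hm h.hsum h.hρ hσ

/-- Weakening the constant. [folklore] -/
theorem mono (h : RowData κ d R T m ρ) {ρ' : ℝ} (hle : ρ ≤ ρ') : RowData κ d R T m ρ' :=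
  ⟨h.ha, h.hm, h.hsum, fun i => (h.hρ i).trans hle⟩

end RowData

/-- **`TermData → RowData`**: termwise constants with `Σ_w ρ_w ≤ ρ` give row data with constant `ρ`
(`majSum_row_le_of_termwise` BY NAME) — so everything landed in the termwise currency embeds. [folklore] -/
theorem rowData_of_termData {T : W → ℂ → Matrix n n ℂ} {m : W → n → n → ℝ} {ρw : W → ℝ}
    (h : TermData κ d R T m ρw) (hw : WeightHyp κ d) (hR : 0 < R) {ρ : ℝ} (hρ : ∑' w, ρw w ≤ ρ) :
    RowData κ d R T m ρ :=
  ⟨h.ha, h.hm, h.hsum hw hR, majSum_row_le_of_termwise (h.hsum hw hR) h.hrow h.hρw hρ⟩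

/-! ## §2 Closure with volume-free constants -/

section Reindex

variable {T : W → ℂ → Matrix n n ℂ} {m : W → n → n → ℝ} {ρ : ℝ}

omit [Fintype n] in
/-- Re-indexing does not change the summed majorant. [folklore] -/
theorem majSum_reindex (m : W → n → n → ℝ) (e : V ≃ W) : majSum (fun v => m (e v)) = majSum m := by
  funext i j
  exact e.tsum_eq fun w => m w i j

/-- **Re-indexing** preserves row data (same constant). [folklore] -/
theorem RowData.reindex (h : RowData κ d R T m ρ) (e : V ≃ W) :
    RowData κ d R (fun v => T (e v)) (fun v => m (e v)) ρ where
  ha v := h.ha (e v)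
  hm v := h.hm (e v)
  hsum i j := (e.summable_iff (f := fun w => m w i j)).2 (h.hsum i j)
  hρ i := by rw [majSum_reindex m e]; exact h.hρ i

end Reindex

section SumFamily

variable {T : W → ℂ → Matrix n n ℂ} {m : W → n → n → ℝ} {ρ : ℝ}
  {S : V → ℂ → Matrix n n ℂ} {m' : V → n → n → ℝ} {ρ' : ℝ}

omit [Fintype n] in
/-- The summed majorant of a sum family is the sum of the summed majorants. [folklore] -/
theorem majSum_sum (hT : ∀ i j, Summable fun w => m w i j) (hS : ∀ i j, Summable fun v => m' v i j) (i j : n) :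
    majSum (Sum.elim m m') i j = majSum m i j + majSum m' i j := by
  simp only [majSum]
  rw [Summable.tsum_sum (by simpa only [Function.comp_def, Sum.elim_inl] using hT i j)
    (by simpa only [Function.comp_def, Sum.elim_inr] using hS i j)]
  simp only [Sum.elim_inl, Sum.elim_inr]

/-- **Sum of two families**: row data with constant `ρ + ρ′`. [folklore] -/
theorem RowData.sum (hT : RowData κ d R T m ρ) (hS : RowData κ d R S m' ρ') :
    RowData κ d R (Sum.elim T S) (Sum.elim m m') (ρ + ρ') where
  ha := by rintro (w | v) i j <;> simp only [Sum.elim_inl, Sum.elim_inr] <;> first | exact hT.ha w i j | exact hS.ha v i j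
  hm := by rintro (w | v) σ hσ i j <;> simp only [Sum.elim_inl, Sum.elim_inr] <;>
    first | exact hT.hm w σ hσ i j | exact hS.hm v σ hσ i j
  hsum i j := Summable.sum _ (by simpa only [Function.comp_def, Sum.elim_inl] using hT.hsum i j)
    (by simpa only [Function.comp_def, Sum.elim_inr] using hS.hsum i j)
  hρ i := by
    calc ∑ j, majSum (Sum.elim m m') i j * Real.exp (κ * d i j)
        = ∑ j, majSum m i j * Real.exp (κ * d i j) + ∑ j, majSum m' i j * Real.exp (κ * d i j) := by
          rw [← Finset.sum_add_distrib]
          exact Finset.sum_congr rfl fun j _ => by rw [majSum_sum hT.hsum hS.hsum, add_mul]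
      _ ≤ ρ + ρ' := add_le_add (hT.hρ i) (hS.hρ i)

/-- The summed operator of the sum family is the sum of the summed operators (on the disc). [folklore] -/
theorem termSum_sum' (hT : RowData κ d R T m ρ) (hS : RowData κ d R S m' ρ') {σ : ℂ} (hσ : σ ∈ ball (0 : ℂ) R) :
    termSum (Sum.elim T S) σ = termSum T σ + termSum S σ := by
  ext i j
  simp only [termSum, Matrix.add_apply]
  rw [Summable.tsum_sum (by simpa only [Function.comp_def, Sum.elim_inl] using hT.summable hσ i j)
    (by simpa only [Function.comp_def, Sum.elim_inr] using hS.summable hσ i j)]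
  simp only [Sum.elim_inl, Sum.elim_inr]

end SumFamily

section Smul

variable {T : W → ℂ → Matrix n n ℂ} {m : W → n → n → ℝ} {ρ : ℝ}

omit [Fintype n] in
/-- The summed majorant of the scaled family. [folklore] -/
theorem majSum_smul (m : W → n → n → ℝ) (X : ℝ) (i j : n) :
    majSum (fun w i j => X * m w i j) i j = X * majSum m i j := by
  simp only [majSum]
  exact tsum_mul_left

/-- **Scalar multiple by a scalar of modulus `≤ X`**: row data with constant `X·ρ` — the x-UNIFORM form. [folklore] -/
theorem RowData.smul (h : RowData κ d R T m ρ) {c : ℂ} {X : ℝ} (hc : ‖c‖ ≤ X) :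
    RowData κ d R (fun w σ => c • T w σ) (fun w i j => X * m w i j) (X * ρ) where
  ha w i j := by
    simp only [Matrix.smul_apply, smul_eq_mul]
    exact (h.ha w i j).const_mul c
  hm w σ hσ i j := by
    rw [Matrix.smul_apply, smul_eq_mul, norm_mul]
    exact mul_le_mul hc (h.hm w σ hσ i j) (norm_nonneg _) ((norm_nonneg c).trans hc)
  hsum i j := (h.hsum i j).mul_left X
  hρ i := by
    have hX : 0 ≤ X := (norm_nonneg c).trans hc
    calc ∑ j, majSum (fun w i j => X * m w i j) i j * Real.exp (κ * d i j)
        = X * ∑ j, majSum m i j * Real.exp (κ * d i j) := by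
          rw [Finset.mul_sum]
          exact Finset.sum_congr rfl fun j _ => by rw [majSum_smul]; ring
      _ ≤ X * ρ := mul_le_mul_of_nonneg_left (h.hρ i) hX

end Smul

section Prod

variable {T : W → ℂ → Matrix n n ℂ} {m : W → n → n → ℝ} {ρ : ℝ}
  {S : V → ℂ → Matrix n n ℂ} {m' : V → n → n → ℝ} {ρ' : ℝ}

/-- The Cauchy product for REAL nonnegative summable families, entrywise: `Σ_{(w,v)} Σ_k m_w(i,k)m′_v(k,j) =
Σ_k (Σ_w m_w(i,k))(Σ_v m′_v(k,j))`. [folklore] -/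
theorem tsum_prodMaj_eq (hT : ∀ i j, Summable fun w => m w i j) (hS : ∀ i j, Summable fun v => m' v i j)
    (hT0 : ∀ w i j, 0 ≤ m w i j) (hS0 : ∀ v i j, 0 ≤ m' v i j) (i j : n) :
    ∑' p : W × V, prodMaj m m' p i j = ∑ k, majSum m i k * majSum m' k j := by
  have hTn : ∀ i k, Summable fun w => ‖m w i k‖ := fun i k =>
    (hT i k).congr fun w => (Real.norm_of_nonneg (hT0 w i k)).symm
  have hSn : ∀ k j, Summable fun v => ‖m' v k j‖ := fun k j =>
    (hS k j).congr fun v => (Real.norm_of_nonneg (hS0 v k j)).symm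
  simp only [AnalyticWalkSum216Algebra.prodMaj_apply, majSum]
  rw [Summable.tsum_finsetSum (fun k _ => summable_mul_of_summable_norm (hTn i k) (hSn k j))]
  exact Finset.sum_congr rfl fun k _ => (tsum_mul_tsum_of_summable_norm (hTn i k) (hSn k j)).symm

/-- **The summed product majorant IS the matrix product of the summed majorants** (as real matrices `Matrix.of`). [folklore] -/
theorem majSum_prod (hT : RowData κ d R T m ρ) (hS : RowData κ d R S m' ρ') (hR : 0 < R) :
    Matrix.of (majSum (prodMaj m m')) = Matrix.of (majSum m) * Matrix.of (majSum m') := by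
  ext i j
  rw [Matrix.mul_apply, Matrix.of_apply]
  simp only [Matrix.of_apply]
  exact tsum_prodMaj_eq hT.hsum hS.hsum (fun w => hT.m_nonneg hR w) (fun v => hS.m_nonneg hR v) i j

/-- **PRODUCTS of walk-term families carry row data with constant `ρρ′` — NO volume factor**: analyticity and the
termwise majorant as in the termwise twin; entrywise summability over `W × V` by the finite middle sum of products of
summable nonnegative families; and the rows of the summed product majorant `= (majSum m)(majSum m′)` bounded by
`B13PerturbativeStep.WRS.mul` on the two real majorants. [folklore] -/
theorem RowData.prod (hT : RowData κ d R T m ρ) (hS : RowData κ d R S m' ρ') (hw : WeightHyp κ d) (hR : 0 < R) :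
    RowData κ d R (prodTerm T S) (prodMaj m m') (ρ * ρ') where
  ha p i j := by
    simp only [AnalyticWalkSum216Algebra.prodTerm_apply, Matrix.mul_apply]
    exact DifferentiableOn.fun_sum fun k _ => (hT.ha p.1 i k).mul (hS.ha p.2 k j)
  hm p σ hσ i j := by
    rw [AnalyticWalkSum216Algebra.prodTerm_apply, Matrix.mul_apply, AnalyticWalkSum216Algebra.prodMaj_apply]
    exact (norm_sum_le _ _).trans (Finset.sum_le_sum fun k _ => (norm_mul_le _ _).trans
      (mul_le_mul (hT.hm p.1 σ hσ i k) (hS.hm p.2 σ hσ k j) (norm_nonneg _) (hT.m_nonneg hR p.1 i k)))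
  hsum i j := by
    simp only [AnalyticWalkSum216Algebra.prodMaj_apply]
    exact summable_sum fun k _ =>
      (hT.hsum i k).mul_of_nonneg (hS.hsum k j) (fun w => hT.m_nonneg hR w i k) (fun v => hS.m_nonneg hR v k j)
  hρ i := by
    have hW := (hT.wrs_majSum hR).mul hw (hS.wrs_majSum hR)
    have h := hW i
    rw [← majSum_prod hT hS hR] at h
    refine le_of_eq_of_le (Finset.sum_congr rfl fun j _ => ?_) h
    rw [Matrix.of_apply, Real.norm_of_nonneg]
    simp only [majSum, AnalyticWalkSum216Algebra.prodMaj_apply]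
    exact tsum_nonneg fun p => Finset.sum_nonneg fun k _ =>
      mul_nonneg (hT.m_nonneg hR p.1 i k) (hS.m_nonneg hR p.2 k j)

/-- **`termSum` is multiplicative under row data**: `termSum (prodTerm T S) σ = termSum T σ * termSum S σ` on the disc.
[cite: Balaban1985BackgroundPropagators, p.432 after (3.186)] -/
theorem termSum_prod' (hT : RowData κ d R T m ρ) (hS : RowData κ d R S m' ρ') {σ : ℂ} (hσ : σ ∈ ball (0 : ℂ) R) :
    termSum (prodTerm T S) σ = termSum T σ * termSum S σ := by
  ext i j
  have h := tsum_mul_apply_of_summable_norm (A := fun w => T w σ) (B := fun v => S v σ)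
    (fun i k => hT.summable_norm hσ i k) (fun k j => hS.summable_norm hσ k j) i j
  simp only [termSum, AnalyticWalkSum216Algebra.prodTerm_apply, Matrix.mul_apply] at h ⊢
  exact h

end Prod

/-! ## §3 Non-vacuity -/

/-- The hypothesis structure is inhabited (the sibling's example, transported): one bond, one walk, `T(σ) = σ` on the
unit disc, majorant `1`, trivial distance, constant `1`. [folklore] -/
theorem rowData_example : RowData (n := Unit) (W := Unit) 0 (fun _ _ => 0) 1 (fun _ σ => fun _ _ => σ)
    (fun _ _ _ => 1) 1 :=
  rowData_of_termData AnalyticWalkSum216Algebra.termData_example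
    ⟨le_rfl, fun _ => rfl, fun _ _ => le_rfl, fun _ _ _ => by simp⟩ one_pos (by simp)

/-- … and so is that of the product closure, with constant `1·1` (no volume factor to be seen at one site, but the
constant is the product of the constants, not a sum over pairs of terms). [folklore] -/
example : RowData (n := Unit) 0 (fun _ _ => 0) 1
    (prodTerm (fun (_ : Unit) (σ : ℂ) => fun (_ _ : Unit) => σ) (fun (_ : Unit) (σ : ℂ) => fun (_ _ : Unit) => σ))
    (prodMaj (fun _ _ _ => (1 : ℝ)) (fun _ _ _ => (1 : ℝ))) (1 * 1) :=
  rowData_example.prod rowData_example ⟨le_rfl, fun _ => rfl, fun _ _ => le_rfl, fun _ _ _ => by simp⟩ one_pos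

end

end Summit.QuantumFields.BalabanUV.Beta.AnalyticWalkSum216RowData
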